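import Summits.QuantumFields.YangMills.Theorems.UnitScaleTiltProp7GaugeSliceDecomposition
import HarnessLib

/-!
# Route `UnitScaleTilt`, crux K1 child «MinimiserStabilityRegPr» (stmt-QuantumFields-19200), skeleton v10, stub `stub_existenceMinimalOrbit` (EX),
# route (α) — **THE `𝔰𝔲(2)` SLICE∕GAUGE SPLIT IN THE `hsplit` CURRENCY OF ★★`Prop7TangentCriticalSplit.tangentCritical_su2_of_split`**: at the background `U₀`, every `𝔰𝔲(2)`-valued fine
# vector field `ξ` with `QTwS U₀ ξ = 0` is `ξ(b) = τ(b) + (iN(b₋) − U₀(b)·iN(b₊)·U₀(b)⋆)` with `N` HERMITIAN TRACELESS (a genuine infinitesimal gauge parameter), the gauge term `Q`-invisible,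
# and `τ` `𝔰𝔲(2)`-valued in print's restricted Landau slice (`QTwS U₀ τ = 0`, `RSPi U₀ (DstarPi U₀ τ) = 0`) — the `b.src ∕ b.tgt` reading of ✓`exists_slice_add_gaugeDir_skew_pi` (v1.1 of this module's parent)

Cell `ym3-torus`, width seat `ym-ust-20520-w4` (gen 5).  THEOREMS ONLY (0 `def`, 0 `sorry`).  ★w2-19200 g4 2026-08-28 13:49:22Z fixed the interface of the repaired (iii) junction: `hsplit : ∀ ξ,
(∀ b, star (ξ b) = -ξ b ∧ (ξ b).trace = 0) → Ker ξ → ∃ τ ∈ T, ∃ N : Site P j → M₂, (∀ x, (N x).IsHermitian ∧ (N x).trace = 0) ∧ ∀ b, ξ b = τ b + (Complex.I • N b.src - ↑(W b) * (Complex.I • N b.tgt) *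
star ↑(W b))` with `Ker ξ := QSym … U′ ξ = 0`, `W := U′` — «(b) `hsplit` = ★w4-20520 g5's REAL split … in the `Complex.I • N`, `b.tgt` currency».  THIS FILE states the seat's `U₀`-letter split in
exactly that currency: the gauge part of ✓`exists_slice_add_gaugeDir_skew_pi` is `toL2⁻¹(D_{U₀}(toL2S l))(b) = η⁻¹(U₀(b)·l(b₊)·U₀(b)⁻¹ − l(b₋))` (✓`DL2_apply`, (3.3)), which IS `iN(b₋) − U₀(b)·iN(b₊)·U₀(b)⋆`
for `N := (i·η⁻¹)•l` — Hermitian traceless because `l` is skew-Hermitian traceless and `η` is real (`U₀(b)⁻¹ = U₀(b)⋆` on `SU(2)`).  The membership `τ ∈ T` (the transported slice at `U′`) is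
★w5-20520 g6's transport; here `τ` carries the `U₀`-slice rows.  Nothing here closes the stub; `--supports stmt-QuantumFields-19200 --as helper`, count-neutral.  YM₃ on T³ is a ladder rung
(R3), not the Clay problem; nothing here claims the stub, the crux, d = 4 or the gap.

THE PRINT.  [Balaban1985BackgroundPropagators] (3.3) p. 391 (the covariant derivative `D_U λ`), (3.20)–(3.23) p. 394, p. 393, (3.110) p. 417; [Balaban1985Variational] (51) p. 286, (82)–(83) p. 290
(the real tangent space and the gauge directions); [Balaban1985RegularSpaces] (1.28)–(1.29) p. 81, Sect. D pp. 89–95.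

WHAT IS PROVED (member `F`, `h : n ≤ K`, weights `c₀ cB`, background `U₀`; sorry-free, no definition):
* `gaugeDir_eq_toL2_symm_DL2` — `iN(b₋) − U₀(b)·iN(b₊)·U₀(b)⋆ = toL2⁻¹(D_{U₀}(toL2S l))(b)` for `N := (i·η⁻¹)•l` (the stencil (3.3), ✓`DL2_apply`);
* `isHermitian_trace_smul_I_eta_inv` — `N := (i·η⁻¹)•l` is Hermitian traceless when `l` is skew-Hermitian traceless;
* ★★★`exists_slice_add_gaugeDir_hsplit (U₀) (hQ) (hQtr) (hQsc) (ξ) (hξ : 𝔰𝔲(2)-valued) (hξQ : QTwS U₀ ξ = 0) : ∃ τ N, (τ 𝔰𝔲(2)-valued) ∧ (∀ x, (N x).IsHermitian ∧ (N x).trace = 0) ∧ QTwS U₀ τ = 0 ∧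
  RSPi U₀ (DstarPi U₀ τ) = 0 ∧ QTwS U₀ (b ↦ iN(b₋) − U₀(b)·iN(b₊)·U₀(b)⋆) = 0 ∧ ∀ b, ξ b = τ b + (Complex.I • N b.src - ↑(U₀ b) * (Complex.I • N b.tgt) * star ↑(U₀ b))`;
  ★★★`exists_slice_add_gaugeDir_hsplit_at_regPr (hε₀ he hWe hWε) (hreg)` — the `QTwS` rows BY NAME at `U₀ ∈ 𝔘_k(ε₀)`.
HONEST SCOPE.  Bookkeeping over landed letters; no estimate; the slice rows of `τ` are AT `U₀` (their transport to `U′ = e^{iX}U₀`∕`QSym` is not here); nothing of print asserted.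

References: T. Bałaban, CMP 99 (1985) 389–434 [Balaban1985BackgroundPropagators] ((3.3) p.391, (3.20)–(3.23) p.394, (3.110) p.417, p.393); CMP 102 (1985) 277–309 [Balaban1985Variational]
((51) p.286, (82)–(83) p.290); CMP 99 (1985) 75–102 [Balaban1985RegularSpaces] ((1.28)–(1.29) p.81, Sect. D pp.89–95).
-/

set_option autoImplicit false

noncomputable section

open scoped InnerProductSpace ComplexConjugate Matrix.Norms.L2Operator BigOperators

namespace Summit.QuantumFields.YangMills.Theorems.Prop7GaugeSliceDecomposition

open Literature.MathematicalPhysics.QuantumFieldTheory.Balaban1983to89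
open Literature.MathematicalPhysics.QuantumFieldTheory.Balaban1983to89.T3ContinuumYM3Torus
open T3SectALandauChart (eta eta_pos)
open T3PrintedRegularMinimiser (RegPr)
open B9Eq311L2Pairing (WL2)
open B11Eq103H1Complex (SiteL2K BondL2K)
open Summit.QuantumFields.YangMills.Theorems.Prop7SectET3Transport (periodsT3 bondEquiv bgOfCfg val_bgOfCfg isUnitaryBg_bgOfCfg)
open Summit.QuantumFields.YangMills.Theorems.Prop7SectET3HilbertLetters (W₂ toL2 toL2S toL2B QL2 DL2 DstarL2 QL2_toL2 DL2_apply)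
open Summit.QuantumFields.YangMills.Theorems.Prop7SymAvgTwSym (QTwS QTwS_star_comm_of_regPr QTwS_scalar_of_regPr QTwS_traceless_of_regPr)
open Summit.QuantumFields.YangMills.Theorems.Prop7SectET3GaugeProjector (NS RSPi DstarPi mem_NS_iff)

variable {F : T3Family} {n K : ℕ} {h : n ≤ K} {c₀ cB : ℝ} [Fact (0 < c₀)]

/-! ## §1 The gauge direction `iN(b₋) − U₀(b)·iN(b₊)·U₀(b)⋆` is the stencil (3.3) of `l := −iη•N`, i.e. `N = (i·η⁻¹)•l` -/

/-- **THE `b.src ∕ b.tgt` GAUGE DIRECTION IS `toL2⁻¹ ∘ D_{U₀} ∘ toL2S` OF THE RESCALED PARAMETER**: for any site function `l` and `N := (i·η⁻¹)•l`,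
`iN(b₋) − U₀(b)·iN(b₊)·U₀(b)⋆ = toL2⁻¹(D_{U₀}(toL2S l))(b)` (✓`DL2_apply`: `η⁻¹(U₀(b)·l(b₊)·U₀(b)⁻¹ − l(b₋))`, `U₀(b)⁻¹ = U₀(b)⋆`, `i·(i·η⁻¹) = −η⁻¹`).
[cite: Balaban1985BackgroundPropagators, (3.3) p.391, (3.5) p.391] -/
theorem gaugeDir_eq_toL2_symm_DL2 (U₀ : GaugeField (F.P K) 0 (Matrix.specialUnitaryGroup (Fin 2) ℂ)) (l : Site (F.P K) 0 → Matrix (Fin 2) (Fin 2) ℂ) (b : PBond (F.P K) 0) :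
    Complex.I • ((Complex.I * (((eta F n K : ℝ) : ℂ))⁻¹) • l b.src) -
        ((U₀ b : Matrix.specialUnitaryGroup (Fin 2) ℂ) : Matrix (Fin 2) (Fin 2) ℂ) * (Complex.I • ((Complex.I * (((eta F n K : ℝ) : ℂ))⁻¹) • l b.tgt)) *
          star (((U₀ b : Matrix.specialUnitaryGroup (Fin 2) ℂ) : Matrix (Fin 2) (Fin 2) ℂ)) =
      (toL2 F K c₀).symm (DL2 F n K c₀ U₀ (toL2S F K c₀ l)) b := by
  have hinv : ((((bgOfCfg F K U₀ (bondEquiv F K b))⁻¹ : (Matrix (Fin 2) (Fin 2) ℂ)ˣ) : Matrix (Fin 2) (Fin 2) ℂ)) =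
      star (((U₀ b : Matrix.specialUnitaryGroup (Fin 2) ℂ) : Matrix (Fin 2) (Fin 2) ℂ)) := by
    rw [isUnitaryBg_bgOfCfg, val_bgOfCfg, Equiv.symm_apply_apply]
  have hII : Complex.I * (Complex.I * (((eta F n K : ℝ) : ℂ))⁻¹) = -(((eta F n K : ℝ) : ℂ))⁻¹ := by
    rw [← mul_assoc, Complex.I_mul_I, neg_one_mul]
  rw [smul_smul, smul_smul, hII, DL2_apply, hinv, Matrix.mul_smul, Matrix.smul_mul, smul_sub, neg_smul, neg_smul, sub_neg_eq_add, neg_add_eq_sub]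

/-- **`N := (i·η⁻¹)•l` IS HERMITIAN TRACELESS WHEN `l` IS SKEW-HERMITIAN TRACELESS** (`η` real: `((i·η⁻¹)•l)ᴴ = (−i·η⁻¹)•lᴴ = (i·η⁻¹)•l`). [cite: Balaban1985BackgroundPropagators, p.393] -/
theorem isHermitian_trace_smul_I_eta_inv {X : Matrix (Fin 2) (Fin 2) ℂ} (hX : star X = -X ∧ X.trace = 0) :
    ((Complex.I * (((eta F n K : ℝ) : ℂ))⁻¹) • X).IsHermitian ∧ ((Complex.I * (((eta F n K : ℝ) : ℂ))⁻¹) • X).trace = 0 := by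
  refine ⟨?_, by rw [Matrix.trace_smul, hX.2, smul_zero]⟩
  rw [Matrix.IsHermitian, Matrix.conjTranspose_smul, ← Matrix.star_eq_conjTranspose, hX.1, star_mul', Complex.star_def, Complex.conj_I,
    ← Complex.ofReal_inv, Complex.conj_ofReal, smul_neg, ← neg_smul, neg_mul, neg_neg]

/-! ## §2 The split in the `hsplit` currency -/

/-- ★★★ **THE `𝔰𝔲(2)` SLICE∕GAUGE SPLIT IN `tangentCritical_su2_of_split`'s CURRENCY**: at a background `U₀` whose averaging is real and sector-respecting (`hQ`, `hQtr`, `hQsc`), every `𝔰𝔲(2)`-valued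
`ξ` with `QTwS U₀ ξ = 0` is `ξ(b) = τ(b) + (iN(b₋) − U₀(b)·iN(b₊)·U₀(b)⋆)` with `N` Hermitian traceless, the gauge term `Q`-invisible, and `τ` `𝔰𝔲(2)`-valued with `QTwS U₀ τ = 0`,
`RSPi U₀ (DstarPi U₀ τ) = 0` (print's linear slice at `U₀`). [cite: Balaban1985BackgroundPropagators, (3.3) p.391, (3.20)–(3.23) p.394, (3.110) p.417; Balaban1985Variational, (51) p.286, (82)–(83) p.290] -/
theorem exists_slice_add_gaugeDir_hsplit [Fact (0 < cB)] (U₀ : GaugeField (F.P K) 0 (Matrix.specialUnitaryGroup (Fin 2) ℂ))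
    (hQ : ∀ A : PBond (F.P K) 0 → Matrix (Fin 2) (Fin 2) ℂ, QTwS F n K h U₀ (star A) = star (QTwS F n K h U₀ A))
    (hQtr : ∀ A : PBond (F.P K) 0 → Matrix (Fin 2) (Fin 2) ℂ, (∀ b, (A b).trace = 0) → ∀ c, (QTwS F n K h U₀ A c).trace = 0)
    (hQsc : ∀ c : PBond (F.P K) 0 → ℂ, ∃ d : PBond (F.P n) 0 → ℂ, QTwS F n K h U₀ (fun b => c b • (1 : Matrix (Fin 2) (Fin 2) ℂ)) = fun c' => d c' • 1)
    (ξ : PBond (F.P K) 0 → Matrix (Fin 2) (Fin 2) ℂ) (hξ : ∀ b, star (ξ b) = -ξ b ∧ (ξ b).trace = 0) (hξQ : QTwS F n K h U₀ ξ = 0) :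
    ∃ (τ : PBond (F.P K) 0 → Matrix (Fin 2) (Fin 2) ℂ) (N : Site (F.P K) 0 → Matrix (Fin 2) (Fin 2) ℂ),
      (∀ b, star (τ b) = -τ b ∧ (τ b).trace = 0) ∧ (∀ x, (N x).IsHermitian ∧ (N x).trace = 0) ∧
      QTwS F n K h U₀ τ = 0 ∧ RSPi F n K h c₀ cB U₀ (DstarPi F n K c₀ U₀ τ) = 0 ∧
      QTwS F n K h U₀ (fun b => Complex.I • N b.src -
          ((U₀ b : Matrix.specialUnitaryGroup (Fin 2) ℂ) : Matrix (Fin 2) (Fin 2) ℂ) * (Complex.I • N b.tgt) * star (((U₀ b : Matrix.specialUnitaryGroup (Fin 2) ℂ) : Matrix (Fin 2) (Fin 2) ℂ))) = 0 ∧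
      ∀ b, ξ b = τ b + (Complex.I • N b.src -
          ((U₀ b : Matrix.specialUnitaryGroup (Fin 2) ℂ) : Matrix (Fin 2) (Fin 2) ℂ) * (Complex.I • N b.tgt) * star (((U₀ b : Matrix.specialUnitaryGroup (Fin 2) ℂ) : Matrix (Fin 2) (Fin 2) ℂ))) := by
  obtain ⟨S, l, hlN, hl, hS, hSQ, hSR, hdec⟩ := exists_slice_add_gaugeDir_skew_pi (h := h) (c₀ := c₀) (cB := cB) U₀ hQ hQtr hQsc ξ hξQ hξ
  -- the gauge direction in the `b.src ∕ b.tgt` currency IS `toL2⁻¹(D(toL2S l))`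
  have hG : (fun b => Complex.I • ((Complex.I * (((eta F n K : ℝ) : ℂ))⁻¹) • l b.src) -
      ((U₀ b : Matrix.specialUnitaryGroup (Fin 2) ℂ) : Matrix (Fin 2) (Fin 2) ℂ) * (Complex.I • ((Complex.I * (((eta F n K : ℝ) : ℂ))⁻¹) • l b.tgt)) *
        star (((U₀ b : Matrix.specialUnitaryGroup (Fin 2) ℂ) : Matrix (Fin 2) (Fin 2) ℂ))) = (toL2 F K c₀).symm (DL2 F n K c₀ U₀ (toL2S F K c₀ l)) :=
    funext fun b => gaugeDir_eq_toL2_symm_DL2 (c₀ := c₀) U₀ l b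
  -- the gauge part is `Q`-invisible (`toL2S l ∈ N_S`)
  have hQG : QTwS F n K h U₀ ((toL2 F K c₀).symm (DL2 F n K c₀ U₀ (toL2S F K c₀ l))) = 0 := by
    have h0 := (mem_NS_iff U₀ _).1 hlN
    rw [← (toL2 F K c₀).apply_symm_apply (DL2 F n K c₀ U₀ (toL2S F K c₀ l)), QL2_toL2] at h0
    exact (toL2B F n cB).map_eq_zero_iff.1 h0
  refine ⟨S, fun x => (Complex.I * (((eta F n K : ℝ) : ℂ))⁻¹) • l x, hS, fun x => isHermitian_trace_smul_I_eta_inv (hl x), hSQ, hSR, ?_, fun b => ?_⟩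
  · rw [hG]; exact hQG
  · rw [gaugeDir_eq_toL2_symm_DL2 (c₀ := c₀) U₀ l b, hdec]; rfl

/-- ★★★ **THE `hsplit`-CURRENCY SPLIT AT `U₀ ∈ 𝔘_k(ε₀)` IN THE WINDOWS `10⁹L²e ≤ 1`, `10¹²L³ε₀ ≤ 1`** — the `QTwS` rows BY NAME (★w5 ✓`QTwS_star_comm_of_regPr`∕`QTwS_traceless_of_regPr`∕
`QTwS_scalar_of_regPr`): no displayed row. [cite: Balaban1985BackgroundPropagators, (3.3) p.391, (3.20)–(3.23) p.394; Balaban1985Variational, (51) p.286, (82)–(83) p.290] -/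
theorem exists_slice_add_gaugeDir_hsplit_at_regPr [Fact (0 < cB)] [Fact (0 < (F.L : ℝ))] [Fact (0 < ((F.L : ℝ)⁻¹) ^ (K - n))]
    {ε₀ e : ℝ} (hε₀ : 0 < ε₀) (he : 0 < e) (hWe : 10 ^ 9 * (F.L : ℝ) ^ 2 * e ≤ 1) (hWε : 10 ^ 12 * (F.L : ℝ) ^ 3 * ε₀ ≤ 1)
    (U₀ : GaugeField (F.P K) 0 (Matrix.specialUnitaryGroup (Fin 2) ℂ)) (hreg : RegPr F n K ε₀ U₀)
    (ξ : PBond (F.P K) 0 → Matrix (Fin 2) (Fin 2) ℂ) (hξ : ∀ b, star (ξ b) = -ξ b ∧ (ξ b).trace = 0) (hξQ : QTwS F n K h U₀ ξ = 0) :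
    ∃ (τ : PBond (F.P K) 0 → Matrix (Fin 2) (Fin 2) ℂ) (N : Site (F.P K) 0 → Matrix (Fin 2) (Fin 2) ℂ),
      (∀ b, star (τ b) = -τ b ∧ (τ b).trace = 0) ∧ (∀ x, (N x).IsHermitian ∧ (N x).trace = 0) ∧
      QTwS F n K h U₀ τ = 0 ∧ RSPi F n K h c₀ cB U₀ (DstarPi F n K c₀ U₀ τ) = 0 ∧
      QTwS F n K h U₀ (fun b => Complex.I • N b.src -
          ((U₀ b : Matrix.specialUnitaryGroup (Fin 2) ℂ) : Matrix (Fin 2) (Fin 2) ℂ) * (Complex.I • N b.tgt) * star (((U₀ b : Matrix.specialUnitaryGroup (Fin 2) ℂ) : Matrix (Fin 2) (Fin 2) ℂ))) = 0 ∧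
      ∀ b, ξ b = τ b + (Complex.I • N b.src -
          ((U₀ b : Matrix.specialUnitaryGroup (Fin 2) ℂ) : Matrix (Fin 2) (Fin 2) ℂ) * (Complex.I • N b.tgt) * star (((U₀ b : Matrix.specialUnitaryGroup (Fin 2) ℂ) : Matrix (Fin 2) (Fin 2) ℂ))) :=
  exists_slice_add_gaugeDir_hsplit U₀ (QTwS_star_comm_of_regPr F h hε₀ he hWe hWε U₀ hreg) (QTwS_traceless_of_regPr F h hε₀ he hWe hWε U₀ hreg)
    (QTwS_scalar_of_regPr F h hε₀ hWε U₀ hreg) ξ hξ hξQ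

end Summit.QuantumFields.YangMills.Theorems.Prop7GaugeSliceDecomposition

end
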